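import Summits.QuantumFields.BalabanUV.Beta.CombHId2W2Vertex2

/-!
# `BalabanUV.Beta.CombHId2W2Sym` — binder row D1 (OWNER an2), (J-a) dictionary, (C2) at ORDER 2, part TWO-c (assembly): **THE OPERATOR's SECOND RESPONSE TABLE,
# COPY-SUMMED IN THE SECOND BOND AND PERIODISED, IS THE SAME TABLE OVER THE PERIODISED SLOTS** —
# `dper M (x z ↦ Σ'_n W2OfK K N S Mt S₂ M₂ b (b′+M′∘n) x z) = W2OfK K N S^per Mt^per S₂^{per,csf} M₂^{per,cs} b b′` — the `W` slot of `CombHId2Periodised`'s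
# headline READ THROUGH its four words (the swapped orientation and `W2SymOfK` follow in `CombHId2W2SymSwap`)

WHY.  `WcombOf j = W2SymOfK (GcombSh j) Lc (SpureCombOf j) (tabs.M j) (T2_j) (M2Of mixFF j)`; `CombHId2Periodised.dper_tsum_e4OfKW_translate` delivered `W^{per,cs}_j` as an
opaque periodised table.  With `CombHId2W2Words ∕ Mixed ∕ Vertex2` (the four words of `W2OfK` under the copy sum) this file closes the order-2 dictionary on the
lattice side: `W^{per,cs}_j` IS `W2SymOfK` over the periodised level-`j` slots, with the second-order slot in the shape `S₂^{per,csf}` that `CombHId2Record` delivers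
for `T2_j` one level down.  (The swapped orientation needs no new word — `W2OfK (b′+M′∘n) b` is the fine-period SHIFT of `W2OfK b′ (b − M′∘n)` by
`SecondOrderResponse.W2OfK_translate`, and `dper` forgets the shift: the sequel `CombHId2W2SymSwap`.)
WHAT ([folklore]; 0 `def`, 0 cited fact, 0 `def … : Prop`, 0 sorry): §8 `summable_of_vertexFamily₂` (pointwise summability in `n` of any `VertexFamily₂` piece),
`dper_add₄`; §9 **`tsum_W2OfK_translate`** (pointwise), **`dper_tsum_W2OfK_translate`**.  Hypotheses: C3a's (`hM hKinv hK hSt hS hMt hMloc`) + `LocStencil₂ S₂`,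
`LocStencilFM N M₂` + the period covariance of `M₂` in its coarse index.
NOT HERE: the swapped orientation ∕ `W2SymOfK` (→ `CombHId2W2SymSwap`), the record instance (`WcombOf`), PART THREE; nothing of Bałaban's asserted; NOT D1,
NEVER «G-an2-4 closed», NOT BetaPertH, NOT continuum, NOT Clay.

HONEST DEPENDENCY (page 1, mandatory): continuum YM on T⁴ ⇐ BetaPertH ∧ nine spine estimates (0/9 proved); BetaPertH ⇐ (D1) ∧ (D4) ∧ CAP+tail;
G-an2-4 gates asym, D1 and NE2/3/4.  HONEST FRAMING (cell contract, verbatim): «discharging `BetaPertH` makes Bałaban's UV stability UNCONDITIONAL —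
a real constructive-QFT result; it is NOT the continuum limit and NOT the Clay problem.»  ABSOLUTE RULE (cell charter, verbatim): «No internally-minted
statement may enter as a cited fact. Every hypothesis is either kernel-proved in this package or a verbatim quotation of a PUBLISHED theorem with page
reference. The manuscript(s) under audit are NOT citable for their own disputed steps — they are the thing under adjudication; programme-internal
(2001/route/tribunal) claims are never citable.»  Row D1 OWNER an2 (b2b-balaban-beta-an2) gen 44, 2026-08-23; over the C3 chain and `SecondOrderResponse` BY NAME.
-/

noncomputable section

open scoped BigOperators

namespace Summit.QuantumFields.BalabanUV.Beta.CombHId2W2Sym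

open Literature.MathematicalPhysics.QuantumFieldTheory.Balaban1983to89
open Literature.MathematicalPhysics.QuantumFieldTheory.Balaban1983to89.Beta
open B12Sec2to5 (l1 l1_nonneg)
open B4TorusKernel.MultiPeriod (translate translate_apply)
open B4Reflection242 (translate_translate)
open B4Sect5Proof (latticeConst latticeConst_nonneg)
open ExpKernelCalculus (MKer Decays BiLoc VertexFamily VertexFamily₂ comp shiftK l1_sub_symm)
open AffineAveraging (Site)
open OneStepResolventKernel (Fib LocStencil biLoc_mono decays_mono)
open OneStepKernelFamily (vertexOfK)
open BalabanCompositeJets (LocStencil₂)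
open BalabanStepJets (locStencil_mono)
open SecondOrderResponse (vertexOfM dM K2OfK vertex2OfK mixOfK W2OfK W2SymOfK LocStencilFM)
open Summit.QuantumFields.BalabanUV.Beta.FP.KernelPeriodisationFibLoc (dper dper_apply dper_translate summable_dper summable_exp_l1_translate decays_dper_diag
  shiftK_eq_translate)
open Summit.QuantumFields.BalabanUV.Beta.CombHId2Letters (dper_K2OfK)
open Summit.QuantumFields.BalabanUV.Beta.CombHId2CopySum (biLoc_tsum_family nsmul_per neg_nsmul_per dper_shiftK_per K2OfK_translate_per)
open Summit.QuantumFields.BalabanUV.Beta.CombHId2Words (exists_biLoc_dM_K2OfK)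
open Summit.QuantumFields.BalabanUV.Beta.CombHId2W2Letters (tsum_dM_shiftK)
open Summit.QuantumFields.BalabanUV.Beta.CombHId2W2Slot (biLoc_vertexOfK_of_biLocAt biLoc_vertexOfM_of_biLocAt dper_tsum_family')
open Summit.QuantumFields.BalabanUV.Beta.CombHId2W2Words (tsum_word₄ dper_tsum_word₄ tsum_word₂ dper_tsum_word₂ biLoc_M₂_cs)
open Summit.QuantumFields.BalabanUV.Beta.CombHId2W2Mixed (tsum_word₃ dper_tsum_word₃' vertexFamily_M₂_csf)
open Summit.QuantumFields.BalabanUV.Beta.CombHId2W2Vertex2 (tsum_word₁₂ dper_tsum_word₁₂ biLoc_S₂_csf)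

variable {d : ℕ} (M : Fin (d + 1) → ℕ) [∀ μ, NeZero (M μ)] {N : ℕ} [NeZero N] {M' : Fin (d + 1) → ℕ} {K : MKer (d + 1) (Fib d)}
  {CK δK CS δS CM δM C₂ δ₂ Cm δm : ℝ} {S Mt : Fin (d + 1) → Site (d + 1) → MKer (d + 1) (Fib d)}
  {S₂ M₂ : Fin (d + 1) → Site (d + 1) → Fin (d + 1) → Site (d + 1) → MKer (d + 1) (Fib d)}

/-! ## §8 Pointwise summability of any `VertexFamily₂` piece under the copy sum; `dper` of a four-term sum -/

omit [NeZero N] in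
/-- [folklore] a `VertexFamily₂` piece read at the second bond's period copies is pointwise summable in `n` (its COLUMN leg decays from `N•(b′+M′∘n)`). -/
theorem summable_of_vertexFamily₂ (hM : ∀ i, M i = N * M' i) {P : Fin (d + 1) → Site (d + 1) → Fin (d + 1) → Site (d + 1) → MKer (d + 1) (Fib d)}
    {C δ : ℝ} (hP : VertexFamily₂ P N C δ) (hδ : 0 < δ) (μ : Fin (d + 1)) (y : Site (d + 1)) (ν : Fin (d + 1)) (y' : Site (d + 1))
    (x z : Site (d + 1)) (a c : Fib d) : Summable fun n : Site (d + 1) => P μ y ν (translate M' y' n) x z a c := by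
  have hC : 0 ≤ C := (hP 0 0 0 0).nonneg (Sum.inl 0)
  refine Summable.of_norm_bounded (((summable_exp_l1_translate M hδ z ((N : ℤ) • y')).1).mul_left C) fun n => ?_
  rw [Real.norm_eq_abs]
  refine (hP μ y ν (translate M' y' n) x z a c).trans ?_
  rw [CombHId1Letters.nsmul_translate hM, mul_add, Real.exp_add, l1_sub_symm z]
  have h1 : Real.exp (-δ * l1 (x - (N : ℤ) • y)) ≤ 1 := by
    rw [Real.exp_le_one_iff]; exact mul_nonpos_of_nonpos_of_nonneg (neg_nonpos.2 hδ.le) (l1_nonneg _)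
  calc C * (Real.exp (-δ * l1 (x - (N : ℤ) • y)) * Real.exp (-δ * l1 (translate M ((N : ℤ) • y') n - z)))
      ≤ C * (1 * Real.exp (-δ * l1 (translate M ((N : ℤ) • y') n - z))) := mul_le_mul_of_nonneg_left (mul_le_mul_of_nonneg_right h1 (Real.exp_pos _).le) hC
    _ = _ := by rw [one_mul]

/-- [folklore] `dper` of a sum of four bi-localised kernels is the sum of the `dper`s. -/
theorem dper_add₄ {A₁ A₂ A₃ A₄ : MKer (d + 1) (Fib d)} (h₁ : ∃ p q C δ, 0 < δ ∧ BiLoc A₁ p q C δ) (h₂ : ∃ p q C δ, 0 < δ ∧ BiLoc A₂ p q C δ)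
    (h₃ : ∃ p q C δ, 0 < δ ∧ BiLoc A₃ p q C δ) (h₄ : ∃ p q C δ, 0 < δ ∧ BiLoc A₄ p q C δ) :
    dper M (A₁ + A₂ + A₃ + A₄) = dper M A₁ + dper M A₂ + dper M A₃ + dper M A₄ := by
  obtain ⟨_, _, _, _, hδa, ha⟩ := h₁
  obtain ⟨_, _, _, _, hδb, hb⟩ := h₂
  obtain ⟨_, _, _, _, hδc, hc⟩ := h₃
  obtain ⟨_, _, _, _, hδd, hd⟩ := h₄
  funext x z e f
  simp only [dper_apply, Pi.add_apply]
  have sa := summable_dper M ha (ha.nonneg (Sum.inl 0)) hδa x z e f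
  have sb := summable_dper M hb (hb.nonneg (Sum.inl 0)) hδb x z e f
  have sc := summable_dper M hc (hc.nonneg (Sum.inl 0)) hδc x z e f
  have sd := summable_dper M hd (hd.nonneg (Sum.inl 0)) hδd x z e f
  rw [((sa.add sb).add sc).tsum_add sd, (sa.add sb).tsum_add sc, sa.tsum_add sb]

/-! ## §9 The unswapped orientation: `W2OfK b (b′+M′∘n)` -/

/-- [folklore] **`Σ'_n W2OfK K N S Mt S₂ M₂ b (b′+M′∘n)`, pointwise, IS the sum of the four copy-summed words** (`W2OfK_apply` + the four pointwise word theorems +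
the pointwise summability of each `VertexFamily₂` piece). -/
theorem tsum_W2OfK_translate (hM : ∀ i, M i = N * M' i)
    (hKinv : ∀ (m x z : Site (d + 1)) (a b : Fib d), K (translate M x m) (translate M z m) a b = K x z a b)
    (hK : Decays K CK δK) (hCK : 0 ≤ CK) (hδK : 0 < δK)
    (hSt : ∀ (κ : Fin (d + 1)) (u m x z : Site (d + 1)) (a b : Fib d), S κ (translate M u m) (translate M x m) (translate M z m) a b = S κ u x z a b)
    (hS : ∀ κ u, BiLoc (S κ u) u u CS δS) (hδS : 0 < δS)
    (hMt : ∀ (ρ : Fin (d + 1)) (w m x z : Site (d + 1)) (a b : Fib d), Mt ρ (translate M' w m) (translate M x m) (translate M z m) a b = Mt ρ w x z a b)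
    (hMloc : VertexFamily Mt N CM δM) (hδM : 0 < δM) (hS₂ : LocStencil₂ S₂ C₂ δ₂) (hδ₂ : 0 < δ₂) (hM₂ : LocStencilFM N M₂ Cm δm) (hδm : 0 < δm)
    (μ : Fin (d + 1)) (y : Site (d + 1)) (ν : Fin (d + 1)) (y' : Site (d + 1)) (x z : Site (d + 1)) (a c : Fib d) :
    ∑' n : Site (d + 1), W2OfK K N S Mt S₂ M₂ μ y ν (translate M' y' n) x z a c
      = vertex2OfK K N (fun κ u κ' u' => fun x z a c => ∑' n : Site (d + 1), S₂ κ u κ' (translate M u' n) x z a c) μ y ν y' x z a c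
        + mixOfK K N (fun κ u ρ w => fun x z a c => ∑' n : Site (d + 1), M₂ κ u ρ (translate M' w n) x z a c) μ y ν y' x z a c
        + mixOfK K N (fun κ u ρ w => fun x z a c => ∑' n : Site (d + 1), M₂ κ (translate M u n) ρ w x z a c) ν y' μ y x z a c
        + dM (dper M (K2OfK K N S Mt ν y')) N S Mt μ y x z a c := by
  -- common rate for the `VertexFamily₂` letters of the four pieces
  have hCS : 0 ≤ CS := (hS 0 0).nonneg (Sum.inl 0)
  have hCMt : 0 ≤ CM := (hMloc 0 0).nonneg (Sum.inl 0)
  set m : ℝ := min (min (min (min δK δS) δM) δ₂) δm with hm_def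
  have hm : 0 < m := lt_min (lt_min (lt_min (lt_min hδK hδS) hδM) hδ₂) hδm
  have hKm : Decays K CK m := decays_mono hK hCK le_rfl ((min_le_left _ _).trans ((min_le_left _ _).trans ((min_le_left _ _).trans (min_le_left _ _))))
  have hSm : LocStencil S CS m := fun κ u =>
    biLoc_mono (hS κ u) hCS ((min_le_left _ _).trans ((min_le_left _ _).trans ((min_le_left _ _).trans (min_le_right _ _))))
  have hMm : VertexFamily Mt N CM m := BalabanStepW2.vertexFamily_mono' hMloc hCMt ((min_le_left _ _).trans ((min_le_left _ _).trans (min_le_right _ _)))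
  have hS₂m : LocStencil₂ S₂ C₂ m := hS₂.mono ((min_le_left _ _).trans (min_le_right _ _))
  have hM₂m : LocStencilFM N M₂ Cm m := hM₂.mono (min_le_right _ _)
  have s₁ := summable_of_vertexFamily₂ M hM (SecondOrderResponse.vertexFamily₂_vertex2OfK (N := N) hKm hCK hS₂m hm) (by positivity) μ y ν y' x z a c
  have s₂ := summable_of_vertexFamily₂ M hM (SecondOrderResponse.vertexFamily₂_mixOfK (N := N) hKm hCK hM₂m hm) (by positivity) μ y ν y' x z a c
  have s₃ := summable_of_vertexFamily₂ M hM (SecondOrderResponse.vertexFamily₂_mixOfK_swap (N := N) hKm hCK hM₂m hm) (by positivity) μ y ν y' x z a c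
  -- the fourth word is the `VertexFamily₂` piece `vertexFamily₂_resp` over `vertexFamily_K2OfK`
  have s₄ := summable_of_vertexFamily₂ M hM
    (SecondOrderResponse.vertexFamily₂_resp (N := N) (SecondOrderResponse.vertexFamily_K2OfK (N := N) hKm hCK hm hSm hMm)
      (locStencil_mono hSm hCS (by linarith)) (BalabanStepW2.vertexFamily_mono' hMm hCMt (by linarith)) (by positivity))
    (by positivity) μ y ν y' x z a c
  -- split the sum of the four words
  have e4 : ∀ n, W2OfK K N S Mt S₂ M₂ μ y ν (translate M' y' n) x z a c
      = vertex2OfK K N S₂ μ y ν (translate M' y' n) x z a c + mixOfK K N M₂ μ y ν (translate M' y' n) x z a c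
        + mixOfK K N M₂ ν (translate M' y' n) μ y x z a c + dM (K2OfK K N S Mt ν (translate M' y' n)) N S Mt μ y x z a c := fun n => by
    rw [SecondOrderResponse.W2OfK_apply]; rfl
  simp only [e4]
  rw [((s₁.add s₂).add s₃).tsum_add s₄, (s₁.add s₂).tsum_add s₃, s₁.tsum_add s₂,
    tsum_word₁₂ M hM hKinv hK hδK hS₂ hδ₂ μ y ν y' x z a c, tsum_word₂ M hM hKinv hK hδK hM₂ hδm μ y ν y' x z a c,
    tsum_word₃ M hM hKinv hK hδK hM₂ hδm μ y ν y' x z a c, tsum_word₄ M hM hKinv hK hδK hSt hS hδS hMt hMloc hδM μ y ν y' x z a c]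

/-- [folklore] **THE UNSWAPPED ORIENTATION, PERIODISED**: `dper M (x z ↦ Σ'_n W2OfK K N S Mt S₂ M₂ b (b′+M′∘n) x z) = W2OfK K N S^per Mt^per S₂^{per,csf} M₂^{per,cs} b b′`
(the four periodised words; `dper_add₄` on their bi-localised copy-summed forms; the mixed table's joint period covariance identifies word 3's copy sum). -/
theorem dper_tsum_W2OfK_translate (hM : ∀ i, M i = N * M' i)
    (hKinv : ∀ (m x z : Site (d + 1)) (a b : Fib d), K (translate M x m) (translate M z m) a b = K x z a b)
    (hK : Decays K CK δK) (hCK : 0 ≤ CK) (hδK : 0 < δK)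
    (hSt : ∀ (κ : Fin (d + 1)) (u m x z : Site (d + 1)) (a b : Fib d), S κ (translate M u m) (translate M x m) (translate M z m) a b = S κ u x z a b)
    (hS : ∀ κ u, BiLoc (S κ u) u u CS δS) (hδS : 0 < δS)
    (hMt : ∀ (ρ : Fin (d + 1)) (w m x z : Site (d + 1)) (a b : Fib d), Mt ρ (translate M' w m) (translate M x m) (translate M z m) a b = Mt ρ w x z a b)
    (hMloc : VertexFamily Mt N CM δM) (hδM : 0 < δM) (hS₂ : LocStencil₂ S₂ C₂ δ₂) (hδ₂ : 0 < δ₂) (hM₂ : LocStencilFM N M₂ Cm δm) (hδm : 0 < δm)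
    (hM₂t : ∀ (κ : Fin (d + 1)) (u : Site (d + 1)) (ρ : Fin (d + 1)) (w m x z : Site (d + 1)) (a c : Fib d),
      M₂ κ (translate M u m) ρ (translate M' w m) (translate M x m) (translate M z m) a c = M₂ κ u ρ w x z a c)
    (μ : Fin (d + 1)) (y : Site (d + 1)) (ν : Fin (d + 1)) (y' : Site (d + 1)) :
    dper M (fun x z a c => ∑' n : Site (d + 1), W2OfK K N S Mt S₂ M₂ μ y ν (translate M' y' n) x z a c)
      = W2OfK K N (fun κ u => dper M (S κ u)) (fun ρ w => dper M (Mt ρ w))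
          (fun κ u κ' u' => dper M (fun x z a c => ∑' n : Site (d + 1), S₂ κ u κ' (translate M u' n) x z a c))
          (fun κ u ρ w => dper M (fun x z a c => ∑' n : Site (d + 1), M₂ κ u ρ (translate M' w n) x z a c)) μ y ν y' := by
  -- the four copy-summed words as kernels, each bi-localised
  have hA₁i := fun κ u => biLoc_vertexOfK_of_biLocAt (N := N) hK hδK (biLoc_S₂_csf M hS₂ hδ₂ κ u) ν y'
  have hA₁ := CombHId1Sandwich.biLoc_vertexOfK (N := N) hK hδK hA₁i hδ₂ μ y
  have hA₂i := fun κ u => biLoc_vertexOfM_of_biLocAt (N := N) hK hδK (biLoc_M₂_cs M hM hM₂ hδm κ u) ν y'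
  have hA₂ := CombHId1Sandwich.biLoc_vertexOfK (N := N) hK hδK hA₂i hδm μ y
  have hC3 : 0 ≤ Cm * latticeConst (d + 1) (δm / 3) := mul_nonneg hM₂.nonneg (latticeConst_nonneg _ (by positivity))
  set r : ℝ := min δK (δm / 3) with hr
  have hr0 : 0 < r := lt_min hδK (by positivity)
  have hA₃i := fun κ u => SecondOrderResponse.vertexFamily_vertexOfM (N := N) hK hCK
    (BalabanStepW2.vertexFamily_mono' (vertexFamily_M₂_csf M (N := N) hM₂ hδm κ u) hC3 (min_le_right _ _)) hr0 (min_le_left _ _) μ y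
  have hA₃ := biLoc_vertexOfK_of_biLocAt (N := N) hK hδK hA₃i ν y'
  obtain ⟨C₀, δ₀, hδ₀, -, hK2⟩ := exists_biLoc_dM_K2OfK hK hδK hS hδS hMloc hδM
  have hC₀ : 0 ≤ C₀ := (hK2 0 0).nonneg (Sum.inl 0)
  have hVd := decays_dper_diag M (hK2 ν y') hC₀ hδ₀
  have hCV : 0 ≤ C₀ * latticeConst (d + 1) (δ₀ / 2) := mul_nonneg hC₀ (latticeConst_nonneg _ (half_pos hδ₀).le)
  set r' : ℝ := min (δ₀ / 2) (min δS δM) with hr'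
  have hr'0 : 0 < r' := lt_min (half_pos hδ₀) (lt_min hδS hδM)
  have hCS : 0 ≤ CS := (hS 0 0).nonneg (Sum.inl 0)
  have hCMt : 0 ≤ CM := (hMloc 0 0).nonneg (Sum.inl 0)
  have hA₄ := SecondOrderResponse.vertexFamily_dM (N := N) hVd hCV
    (fun κ u => biLoc_mono (hS κ u) hCS ((min_le_right _ _).trans (min_le_left _ _)) : LocStencil S CS r')
    (BalabanStepW2.vertexFamily_mono' hMloc hCMt ((min_le_right _ _).trans (min_le_right _ _))) hr'0 (min_le_left _ _) μ y
  have h1 : (fun x z a c => ∑' n : Site (d + 1), W2OfK K N S Mt S₂ M₂ μ y ν (translate M' y' n) x z a c)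
      = vertex2OfK K N (fun κ u κ' u' => fun x z a c => ∑' n : Site (d + 1), S₂ κ u κ' (translate M u' n) x z a c) μ y ν y'
        + mixOfK K N (fun κ u ρ w => fun x z a c => ∑' n : Site (d + 1), M₂ κ u ρ (translate M' w n) x z a c) μ y ν y'
        + mixOfK K N (fun κ u ρ w => fun x z a c => ∑' n : Site (d + 1), M₂ κ (translate M u n) ρ w x z a c) ν y' μ y
        + dM (dper M (K2OfK K N S Mt ν y')) N S Mt μ y := by
    funext x z a c
    rw [tsum_W2OfK_translate M hM hKinv hK hCK hδK hSt hS hδS hMt hMloc hδM hS₂ hδ₂ hM₂ hδm μ y ν y' x z a c]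
    rfl
  -- the four periodised words
  have e₁ := dper_tsum_word₁₂ M hM hKinv hK hδK hS₂ hδ₂ μ y ν y'
  have e₂ := dper_tsum_word₂ M hM hKinv hK hδK hM₂ hδm μ y ν y'
  have e₃ := dper_tsum_word₃' M hM hKinv hK hCK hδK hM₂ hδm hM₂t μ y ν y'
  have e₄ := dper_tsum_word₄ M hM hKinv hK hCK hδK hSt hS hδS hMt hMloc hδM μ y ν y'
  -- identify their left sides with `dper` of the kernels `A₁ … A₄`
  have f₁ : (fun x z a c => ∑' n : Site (d + 1), vertex2OfK K N S₂ μ y ν (translate M' y' n) x z a c)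
      = vertex2OfK K N (fun κ u κ' u' => fun x z a c => ∑' n : Site (d + 1), S₂ κ u κ' (translate M u' n) x z a c) μ y ν y' := by
    funext x z a c; exact tsum_word₁₂ M hM hKinv hK hδK hS₂ hδ₂ μ y ν y' x z a c
  have f₂ : (fun x z a c => ∑' n : Site (d + 1), mixOfK K N M₂ μ y ν (translate M' y' n) x z a c)
      = mixOfK K N (fun κ u ρ w => fun x z a c => ∑' n : Site (d + 1), M₂ κ u ρ (translate M' w n) x z a c) μ y ν y' := by
    funext x z a c; exact tsum_word₂ M hM hKinv hK hδK hM₂ hδm μ y ν y' x z a c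
  have f₃ : (fun x z a c => ∑' n : Site (d + 1), mixOfK K N M₂ ν (translate M' y' n) μ y x z a c)
      = mixOfK K N (fun κ u ρ w => fun x z a c => ∑' n : Site (d + 1), M₂ κ (translate M u n) ρ w x z a c) ν y' μ y := by
    funext x z a c; exact tsum_word₃ M hM hKinv hK hδK hM₂ hδm μ y ν y' x z a c
  have f₄ : (fun x z a c => ∑' n : Site (d + 1), dM (K2OfK K N S Mt ν (translate M' y' n)) N S Mt μ y x z a c)
      = dM (dper M (K2OfK K N S Mt ν y')) N S Mt μ y := by
    funext x z a c; exact tsum_word₄ M hM hKinv hK hδK hSt hS hδS hMt hMloc hδM μ y ν y' x z a c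
  rw [f₁] at e₁; rw [f₂] at e₂; rw [f₃] at e₃; rw [f₄] at e₄
  rw [h1, dper_add₄ M
    (A₁ := vertex2OfK K N (fun κ u κ' u' => fun x z a c => ∑' n : Site (d + 1), S₂ κ u κ' (translate M u' n) x z a c) μ y ν y')
    (A₂ := mixOfK K N (fun κ u ρ w => fun x z a c => ∑' n : Site (d + 1), M₂ κ u ρ (translate M' w n) x z a c) μ y ν y')
    (A₃ := mixOfK K N (fun κ u ρ w => fun x z a c => ∑' n : Site (d + 1), M₂ κ (translate M u n) ρ w x z a c) ν y' μ y)
    (A₄ := dM (dper M (K2OfK K N S Mt ν y')) N S Mt μ y)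
    ⟨_, _, _, _, half_pos (lt_min hδK hδ₂), hA₁⟩ ⟨_, _, _, _, half_pos (lt_min hδK hδm), hA₂⟩ ⟨_, _, _, _, half_pos hr0, hA₃⟩
    ⟨_, _, _, _, half_pos hr'0, hA₄⟩, e₁, e₂, e₃, e₄]
  rfl

end Summit.QuantumFields.BalabanUV.Beta.CombHId2W2Sym

end
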